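import Literature.NumberTheory.ComplexMultiplication.CMAlgebraLatticeTraceDual
import HarnessLib

/-!
# GORENSTEIN ORDERS in a CM-ALGEBRA `Y = L_1 ⊕ ⋯ ⊕ L_t`: the trace-dual calculus `(I ∩ J)^t = I^t + J^t`,
# `(I:J) = (J^t:I^t)`, `S = (I:I) ⟺ II^t = S^t`, `((I:J):L) = (I:JL)` (Marseglia 2019 Lemmas 2.1, 2.3) and the
# BUCHMANN–LENSTRA ∕ BASS criterion (Marseglia 2019 Prop. 2.10): for an order `R ⊂ Y` the following are
# equivalent — (1) every fractional `R`-ideal is reflexive, `(R:(R:I)) = I`; (2) every `I` with `(I:I) = R` is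
# invertible; (3) the trace dual `R^t` is invertible

Topic `Literature/NumberTheory/ComplexMultiplication`, namespace `Literature.NumberTheory.ComplexMultiplication`;
lane `lit-hodgefound` (Track 2 foundations library), Layer A3, seat p19 generation 31, row g31-#8 — sequel of
g31-#5 (`CMAlgebraLatticeSemigroup`: colon `M / N`, order `𝒪(M) = M / M`, Krull–DTZ invertibility
`M·(𝒪(M):M) = 𝒪(M)`) and g31-#6 (`CMAlgebraLatticeTraceDual`: `M^t := (Algebra.traceForm ℚ Y).dualSubmodule M`,
`M^tt = M`, `(MN)^t = M^t : N`, `M·M^t = 𝒪(M)^t`).  Marseglia's `K` is «a finite product of number fields» — the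
tree's `Y = ∏ᵢ Lᵢ` — and his fractional `R`-ideals are the full `ℤ`-lattices `I ⊂ Y` with `RI ⊆ I`
(`Literature.NumberTheory.Automorphic.IsFullLattice`).  The point of the criterion for the lane («exact class numbers
for an arbitrary CM-algebra order», gen-30 desk): for a GORENSTEIN over-order `S ⊇ R` the `ε`-classes with
`𝒪(L) = S` (g31-#2 `ICM_S`) are exactly the invertible ones, the group `Pic(S)`.  THEOREMS ONLY: no definition, no
instance, no named fact (D-0026, net Literature debt `0`), no `sorry`.

RELATION TO THE TREE: for ONE number field `K` and the carrier `FractionalIdeal (endOrder (leftMulMatrix μ))⁰ K`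
(orders `endOrder`, trace duals as hypotheses `↑T = Submodule.traceDual ℤ ℚ ↑I`), Lemma 2.3 and Prop. 2.10 are the
tree's `CMOrderGorenstein.lean` (seat p15, g25-#1: `CMTypeLattice.forall_div_div_eq_iff_traceDual_mul_div_eq`,
`CMTypeLattice.div_self_eq_iff_mul_traceDual_eq`, `CMTypeLattice.coe_add_eq_traceDual_inf`,
`EndOrder.div_mul_eq_div_div_fractionalIdeal`, …) with its sequels `CMOrderTraceDualClasses`, `CMOrderBassClifford`,
`CMOrderGorensteinWeakClassesCount`.  The present file is the CM-ALGEBRA version — `Y = ∏ᵢ Lᵢ` with zero divisors,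
arbitrary full `ℤ`-lattices `Submodule ℤ Y`, orders as idempotent lattices of the Dade–Taussky–Zassenhaus semigroup
(g31-#5) and the trace dual as Mathlib's `BilinForm.dualSubmodule` of the product trace form (g31-#6) — which is
Marseglia's own generality («`K` is a finite product of number fields») and the one the CM-algebra tori of the lane
(`IsCMAlgTorusRat`, g31-#2's lattice classes) live in; nothing here imports or restates the one-field files.

## Source, VERBATIM

S. Marseglia, *Computing the ideal class monoid of an order*, J. London Math. Soc. (2) 101 (2020) 984–1007,
arXiv:1805.09671 [Marseglia2019], held `paper:arxiv-1805.09671`, §2 (chunks p0004–p0005):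
«An order is a reduced ring `R`, which is free and finitely generated as a ℤ-module. Let `K` be the total quotient
ring of an order `R` […] `K` is a finite product of number fields […] **Lemma 2.1.** Let `I, J, L` be fractional
`R`-ideals, then `((I:J):L) = (I:JL)`. […] For every fractional `R`-ideal `I`, we define the trace dual ideal as
`I^t = {x ∈ K : Tr(xI) ⊆ ℤ}`. […] **Lemma 2.3.** Let `R` be an order in `K`, let `I` and `J` be two fractional
`R`-ideals and let `x` be in `K^×`. • `(I^t)^t = I`, • `I ⊂ J ⟺ J^t ⊂ I^t`, • `(I ∩ J)^t = I^t + J^t`,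
• `(xI)^t = (1/x)I^t`, • `(I:J) = (I^tJ)^t`, • `(I:J) = (J^t:I^t)`, • `S = (I:I) ⟺ II^t = S^t`. […] A fractional
`R`-ideal `I` is said to be invertible in `R` if `IJ = R`, for some fractional `R`-ideal `J`. Observe that if such a
`J` exists then `J = (R:I)`. […] **Proposition 2.10.** [buchlenstra] Let `R` be an order with trace dual `R^t`. The
following are equivalent: • for every fractional `R`-ideal `I`, we have `(R:(R:I)) = I`; • for every fractional
`R`-ideal `I`, we have `(I:I) = R` if and only if `I` is invertible; • `R^t` is invertible in `R`. An order
satisfying one of the equivalent conditions of (2.10) is called Gorenstein. This definition is equivalent to the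
usual one, see [basshy63]. Observe that `𝒪_K` is Gorenstein […]»

## What is proved (`Y = ∏ᵢ Lᵢ`; `M^t := (Algebra.traceForm ℚ Y).dualSubmodule M`; orders `R`: `1 ∈ R`, `RR ⊆ R`, full)

* §1 LEMMA 2.1 `div_mul_eq_div_div` (`I:(JL) = (I:J):L`) and the remaining items of LEMMA 2.3: `traceDual_sup`
  (`(I+J)^t = I^t ∩ J^t`), `isFullLattice_sup`, **`traceDual_inf`** (`(I ∩ J)^t = I^t + J^t`),
  **`div_eq_traceDual_div_traceDual`** (`(I:J) = (J^t:I^t)`), **`div_self_eq_iff_mul_traceDual_eq`**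
  (`S = (I:I) ⟺ II^t = S^t`); and `div_self_eq_of_mul_eq_of_le` («if `IJ = R` then» `(I:I) = R`) with
  `eq_div_of_mul_eq` («`J = (R:I)`»).
* §2 PROPOSITION 2.10: **`forall_div_div_eq_of_traceDual_mul_div_eq`** ((3) ⟹ (1)),
  **`forall_mul_div_eq_of_forall_div_div_eq`** ((1) ⟹ (2)), **`traceDual_mul_div_eq_of_forall_mul_div_eq`**
  ((2) ⟹ (3)), packaged as `forall_div_div_eq_iff_traceDual_mul_div_eq` ((1) ⟺ (3)) and
  `forall_mul_div_eq_iff_traceDual_mul_div_eq` ((2) ⟺ (3)); `mul_div_div_eq_of_traceDual_div_self_mul_div_eq` (a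
  lattice with Gorenstein multiplicator ring is invertible in it — «`ICM(R) = ⊔ Pic(S)`» for Bass `R`, Prop. 3.7);
  and «`𝒪_K` is Gorenstein»:
  `traceDual_pi_mul_div_eq` (the maximal order `⊕ᵢ 𝒪_{Lᵢ}` satisfies (3), by g31-#6's Cor. 6.2 (b)).

## References
* [Marseglia2019] S. Marseglia, *Computing the ideal class monoid of an order*, J. LMS (2) 101 (2020) 984–1007,
  arXiv:1805.09671, §2 Lemma 2.1, Lemma 2.3, Prop. 2.10 (chunks p0004–p0005). [cite: Marseglia2019, §2 Prop. 2.10, chunk p0005]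
* [BuchmannLenstra1994] J. A. Buchmann, H. W. Lenstra, *Approximating rings of integers in number fields*, J. Théor.
  Nombres Bordeaux 6 (1994) 221–260 (the source of Prop. 2.10, as cited). [cite: BuchmannLenstra1994, §2 (as cited by Marseglia2019 Prop. 2.10)]
* [HertlingLarabi2026] C. Hertling, K. Larabi, arXiv:2602.14973 (2026), §5 Thm. 5.6 (c) (invertibility), chunk p0012.
  [cite: HertlingLarabi2026, §5 Thm. 5.6 (c), chunk p0012]
-/

noncomputable section

open scoped Classical Pointwise nonZeroDivisors NumberField
open Module NumberField Function

namespace Literature.NumberTheory.ComplexMultiplication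

open Literature.NumberTheory.Automorphic

section Gorenstein

variable {t : Type} {L : t → Type} [∀ i, Field (L i)] [∀ i, NumberField (L i)] [Fintype t]

/-! ## §1 Lemma 2.1 and the rest of Lemma 2.3 -/

omit [∀ i, NumberField (L i)] [Fintype t] in
/-- **LEMMA 2.1: `(I:(JL)) = ((I:J):L)`.** [cite: Marseglia2019, §2 Lemma 2.1, chunk p0004] -/
theorem div_mul_eq_div_div (I J K : Submodule ℤ (Π i, L i)) : I / (J * K) = (I / J) / K := by
  ext x
  simp only [Submodule.mem_div_iff_forall_mul_mem]
  constructor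
  · intro h k hk j hj
    rw [mul_assoc, mul_comm k j]
    exact h _ (Submodule.mul_mem_mul hj hk)
  · intro h y hy
    refine Submodule.mul_induction_on hy (fun j hj k hk => ?_) (fun a b ha hb => ?_)
    · rw [mul_comm j k, ← mul_assoc]
      exact h k hk j hj
    · rw [mul_add]
      exact I.add_mem ha hb

omit [Fintype t] in
/-- **`(I + J)^t = I^t ∩ J^t`.** [cite: Marseglia2019, §2 Lemma 2.3 («`(I∩J)^t = I^t + J^t`», dual form), chunk p0004] -/
theorem traceDual_sup (M N : Submodule ℤ (Π i, L i)) :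
    (Algebra.traceForm ℚ (Π i, L i)).dualSubmodule (M ⊔ N) =
      (Algebra.traceForm ℚ (Π i, L i)).dualSubmodule M ⊓ (Algebra.traceForm ℚ (Π i, L i)).dualSubmodule N := by
  refine le_antisymm (le_inf (traceDual_anti le_sup_left) (traceDual_anti le_sup_right)) fun a ha z hz => ?_
  obtain ⟨m, hm, n, hn, rfl⟩ := Submodule.mem_sup.1 hz
  rw [map_add]
  exact Submodule.add_mem _ (ha.1 m hm) (ha.2 n hn)

omit [∀ i, NumberField (L i)] [Fintype t] in
/-- The sum of a full lattice and a finitely generated submodule is a full lattice. [cite: HertlingLarabi2026, §2 Lemma 2.2 (c) («`L_1 + L_2` and `L_1 ∩ L_2` are full lattices»), chunk p0005] -/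
theorem isFullLattice_sup {M N : Submodule ℤ (Π i, L i)} (hM : IsFullLattice (Π i, L i) M) (hN : N.FG) :
    IsFullLattice (Π i, L i) (M ⊔ N) :=
  ⟨hM.1.sup hN, fun d => (hM.2 d).imp fun _ h => ⟨h.1, Submodule.mem_sup_left h.2⟩⟩

/-- **`(I ∩ J)^t = I^t + J^t`** for full lattices. [cite: Marseglia2019, §2 Lemma 2.3, chunk p0004] -/
theorem traceDual_inf {M N : Submodule ℤ (Π i, L i)} (hM : IsFullLattice (Π i, L i) M)
    (hN : IsFullLattice (Π i, L i) N) :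
    (Algebra.traceForm ℚ (Π i, L i)).dualSubmodule (M ⊓ N) =
      (Algebra.traceForm ℚ (Π i, L i)).dualSubmodule M ⊔ (Algebra.traceForm ℚ (Π i, L i)).dualSubmodule N := by
  have h := traceDual_sup ((Algebra.traceForm ℚ (Π i, L i)).dualSubmodule M)
    ((Algebra.traceForm ℚ (Π i, L i)).dualSubmodule N)
  rw [traceDual_traceDual hM, traceDual_traceDual hN] at h
  rw [← h, traceDual_traceDual (isFullLattice_sup (isFullLattice_traceDual hM) (isFullLattice_traceDual hN).1)]

/-- **`(I:J) = (J^t:I^t)`** (for `I` full). [cite: Marseglia2019, §2 Lemma 2.3, chunk p0004] -/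
theorem div_eq_traceDual_div_traceDual {M : Submodule ℤ (Π i, L i)} (hM : IsFullLattice (Π i, L i) M)
    (N : Submodule ℤ (Π i, L i)) :
    M / N = (Algebra.traceForm ℚ (Π i, L i)).dualSubmodule N / (Algebra.traceForm ℚ (Π i, L i)).dualSubmodule M := by
  rw [div_eq_traceDual hM N, mul_comm, traceDual_mul]

/-- **`S = (I:I) ⟺ II^t = S^t`** (for full `I`, `S`). [cite: Marseglia2019, §2 Lemma 2.3, chunk p0004] -/
theorem div_self_eq_iff_mul_traceDual_eq {M S : Submodule ℤ (Π i, L i)} (hM : IsFullLattice (Π i, L i) M)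
    (hS : IsFullLattice (Π i, L i) S) :
    M / M = S ↔ M * (Algebra.traceForm ℚ (Π i, L i)).dualSubmodule M =
      (Algebra.traceForm ℚ (Π i, L i)).dualSubmodule S := by
  rw [mul_traceDual_eq hM]
  exact ⟨fun h => by rw [h], fun h => traceDual_inj (isFullLattice_div hM hM) hS h⟩

omit [∀ i, NumberField (L i)] [Fintype t] in
/-- An invertible fractional `R`-ideal has multiplicator ring `R`: `IJ = R`, `RI ⊆ I`, `1 ∈ R` ⟹ `(I:I) = R`
(«we have `(I:I) = R` if […] `I` is invertible»). [cite: Marseglia2019, §2 Prop. 2.10 (2) and Lemma 2.2, chunks p0004–p0005] -/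
theorem div_self_eq_of_mul_eq_of_le {R I J : Submodule ℤ (Π i, L i)} (h1 : (1 : Π i, L i) ∈ R) (hIJ : I * J = R)
    (hRI : R * I ≤ I) : I / I = R := by
  refine le_antisymm (fun a ha => ?_) (Submodule.le_div_iff_mul_le.2 hRI)
  -- `a = a·1 ∈ a·IJ ⊆ IJ = R`
  have h1' : (1 : Π i, L i) ∈ I * J := by rw [hIJ]; exact h1
  rw [Submodule.mem_div_iff_forall_mul_mem] at ha
  have key : ∀ w ∈ I * J, a * w ∈ R := fun w hw =>
    Submodule.mul_induction_on hw (fun i hi j hj => by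
        rw [← mul_assoc, ← hIJ]
        exact Submodule.mul_mem_mul (ha i hi) hj)
      (fun x y hx hy => by rw [mul_add]; exact R.add_mem hx hy)
  simpa using key 1 h1'

omit [∀ i, NumberField (L i)] [Fintype t] in
/-- «Observe that if such a `J` exists then `J = (R:I)`»: `IJ = R`, `RJ ⊆ J`, `1 ∈ R` ⟹ `J = (R:I)`.
[cite: Marseglia2019, §2 (before Remark 2.4), chunk p0004] -/
theorem eq_div_of_mul_eq {R I J : Submodule ℤ (Π i, L i)} (h1 : (1 : Π i, L i) ∈ R) (hIJ : I * J = R)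
    (hRJ : R * J ≤ J) : J = R / I := by
  refine le_antisymm (Submodule.le_div_iff_mul_le.2 (by rw [mul_comm, hIJ])) fun x hx => ?_
  rw [Submodule.mem_div_iff_forall_mul_mem] at hx
  have h1' : (1 : Π i, L i) ∈ I * J := by rw [hIJ]; exact h1
  have key : ∀ w ∈ I * J, x * w ∈ J := fun w hw =>
    Submodule.mul_induction_on hw (fun i hi j hj => by
        rw [← mul_assoc]
        exact hRJ (Submodule.mul_mem_mul (hx i hi) hj))
      (fun a b ha hb => by rw [mul_add]; exact J.add_mem ha hb)
  simpa using key 1 h1'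

/-! ## §2 Proposition 2.10: Gorenstein orders -/

/-- **PROP. 2.10, (3) ⟹ (1): if the trace dual `R^t` of the order `R` is invertible (`R^t·(R:R^t) = R`) then every
fractional `R`-ideal is reflexive, `(R:(R:I)) = I`** — `I^t = (RI)^t = R^t : I = R^t·(R:I)` (Lemma 5.3 (5.4) for the
invertible `R^t`, `𝒪(R^t) = 𝒪(R) = R`), so `I = I^tt = R^tt : (R:I) = R : (R:I)`.
[cite: Marseglia2019, §2 Prop. 2.10, chunk p0005] [cite: BuchmannLenstra1994, §2 (as cited by Marseglia2019 Prop. 2.10)] -/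
theorem forall_div_div_eq_of_traceDual_mul_div_eq {R : Submodule ℤ (Π i, L i)} (hR : IsFullLattice (Π i, L i) R)
    (h1 : (1 : Π i, L i) ∈ R) (hRR : R * R ≤ R)
    (h3 : (Algebra.traceForm ℚ (Π i, L i)).dualSubmodule R * (R / (Algebra.traceForm ℚ (Π i, L i)).dualSubmodule R) = R)
    {I : Submodule ℤ (Π i, L i)} (hI : IsFullLattice (Π i, L i) I) (hRI : R * I ≤ I) : R / (R / I) = I := by
  have hO : (Algebra.traceForm ℚ (Π i, L i)).dualSubmodule R / (Algebra.traceForm ℚ (Π i, L i)).dualSubmodule R = R := by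
    rw [div_self_traceDual hR, div_self_eq_of_one_mem h1 hRR]
  have hRIeq : R * I = I :=
    le_antisymm hRI fun x hx => by rw [← one_mul x]; exact Submodule.mul_mem_mul h1 hx
  have hinv : (Algebra.traceForm ℚ (Π i, L i)).dualSubmodule R *
      (((Algebra.traceForm ℚ (Π i, L i)).dualSubmodule R / (Algebra.traceForm ℚ (Π i, L i)).dualSubmodule R) /
        (Algebra.traceForm ℚ (Π i, L i)).dualSubmodule R) =
      (Algebra.traceForm ℚ (Π i, L i)).dualSubmodule R / (Algebra.traceForm ℚ (Π i, L i)).dualSubmodule R := by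
    rw [hO]; exact h3
  -- `I^t = R^t : I = R^t (R : I)`
  have e1 : (Algebra.traceForm ℚ (Π i, L i)).dualSubmodule I =
      (Algebra.traceForm ℚ (Π i, L i)).dualSubmodule R * (R / I) := by
    conv_lhs => rw [← hRIeq, traceDual_mul]
    rw [div_eq_mul_div_of_mul_div_eq hinv I, hO]
  -- dualise
  have e2 : (Algebra.traceForm ℚ (Π i, L i)).dualSubmodule ((Algebra.traceForm ℚ (Π i, L i)).dualSubmodule I) =
      R / (R / I) := by
    rw [e1, traceDual_mul, traceDual_traceDual hR]
  rw [← e2, traceDual_traceDual hI]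

omit [Fintype t] in
/-- **PROP. 2.10, (1) ⟹ (2): if every fractional `R`-ideal is reflexive then every `I` with `(I:I) = R` is
invertible, `I·(R:I) = R`** — for `J = (R:I)`: `𝒪(J) = R` (reflexivity of `I`), `(R:IJ) = ((R:I):J) = 𝒪(J) = R`
(Lemma 2.1), so `IJ = (R:(R:IJ)) = (R:R) = R`. [cite: Marseglia2019, §2 Prop. 2.10 with Lemma 2.1, chunks p0004–p0005] [cite: BuchmannLenstra1994, §2 (as cited by Marseglia2019 Prop. 2.10)] -/
theorem forall_mul_div_eq_of_forall_div_div_eq {R : Submodule ℤ (Π i, L i)} (hR : IsFullLattice (Π i, L i) R)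
    (h1 : (1 : Π i, L i) ∈ R) (hRR : R * R ≤ R)
    (hrefl : ∀ I : Submodule ℤ (Π i, L i), IsFullLattice (Π i, L i) I → R * I ≤ I → R / (R / I) = I)
    {I : Submodule ℤ (Π i, L i)} (hI : IsFullLattice (Π i, L i) I) (hIO : I / I = R) : I * (R / I) = R := by
  have hRI : R * I ≤ I := Submodule.le_div_iff_mul_le.1 hIO.ge
  have hJ : IsFullLattice (Π i, L i) (R / I) := isFullLattice_div hR hI
  -- `J = R : I` is a fractional `R`-ideal
  have hRJ : R * (R / I) ≤ R / I :=
    Submodule.mul_le.2 fun r hr j hj => Submodule.mem_div_iff_forall_mul_mem.2 fun i hi => by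
      rw [mul_assoc]
      exact hRR (Submodule.mul_mem_mul hr ((Submodule.mem_div_iff_forall_mul_mem.1 hj) i hi))
  -- `𝒪(J) = R`
  have hIJ : R / (R / I) = I := hrefl I hI hRI
  have hOJ : (R / I) / (R / I) = R := by
    refine le_antisymm (fun a ha => ?_) (Submodule.le_div_iff_mul_le.2 hRJ)
    rw [← hIO, Submodule.mem_div_iff_forall_mul_mem]
    intro i hi
    rw [← hIJ, Submodule.mem_div_iff_forall_mul_mem]
    intro j hj
    have hi' : i ∈ R / (R / I) := by rw [hIJ]; exact hi
    rw [show a * i * j = i * (a * j) by ring]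
    exact (Submodule.mem_div_iff_forall_mul_mem.1 hi') _
      ((Submodule.mem_div_iff_forall_mul_mem.1 ha) j hj)
  -- `IJ` is a fractional `R`-ideal with `(R : IJ) = 𝒪(J) = R`, hence `IJ = R : R = R`
  have hRIJ : R * (I * (R / I)) ≤ I * (R / I) := by
    rw [← mul_assoc]
    exact mul_le_mul_left hRI _
  have h := hrefl (I * (R / I)) (isFullLattice_mul hI hJ) hRIJ
  rw [div_mul_eq_div_div, hOJ, div_self_eq_of_one_mem h1 hRR] at h
  exact h.symm

/-- **PROP. 2.10, (2) ⟹ (3): if every `I` with `(I:I) = R` is invertible then `R^t` is invertible** (`𝒪(R^t) =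
𝒪(R) = R`). [cite: Marseglia2019, §2 Prop. 2.10, chunk p0005] -/
theorem traceDual_mul_div_eq_of_forall_mul_div_eq {R : Submodule ℤ (Π i, L i)} (hR : IsFullLattice (Π i, L i) R)
    (h1 : (1 : Π i, L i) ∈ R) (hRR : R * R ≤ R)
    (hinv : ∀ I : Submodule ℤ (Π i, L i), IsFullLattice (Π i, L i) I → I / I = R → I * (R / I) = R) :
    (Algebra.traceForm ℚ (Π i, L i)).dualSubmodule R * (R / (Algebra.traceForm ℚ (Π i, L i)).dualSubmodule R) = R :=
  hinv _ (isFullLattice_traceDual hR) (by rw [div_self_traceDual hR, div_self_eq_of_one_mem h1 hRR])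

/-- **PROP. 2.10, (1) ⟺ (3): an order `R` is Gorenstein — every fractional `R`-ideal is reflexive — iff its trace
dual `R^t` is invertible.** [cite: Marseglia2019, §2 Prop. 2.10, chunk p0005] [cite: BuchmannLenstra1994, §2 (as cited by Marseglia2019 Prop. 2.10)] -/
theorem forall_div_div_eq_iff_traceDual_mul_div_eq {R : Submodule ℤ (Π i, L i)} (hR : IsFullLattice (Π i, L i) R)
    (h1 : (1 : Π i, L i) ∈ R) (hRR : R * R ≤ R) :
    (∀ I : Submodule ℤ (Π i, L i), IsFullLattice (Π i, L i) I → R * I ≤ I → R / (R / I) = I) ↔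
      (Algebra.traceForm ℚ (Π i, L i)).dualSubmodule R * (R / (Algebra.traceForm ℚ (Π i, L i)).dualSubmodule R) =
        R :=
  ⟨fun h => traceDual_mul_div_eq_of_forall_mul_div_eq hR h1 hRR
      fun _ hI hIO => forall_mul_div_eq_of_forall_div_div_eq hR h1 hRR h hI hIO,
    fun h _ hI hRI => forall_div_div_eq_of_traceDual_mul_div_eq hR h1 hRR h hI hRI⟩

/-- **PROP. 2.10, (2) ⟺ (3): every full lattice with multiplicator ring `R` is invertible iff `R^t` is
invertible** — for such a Gorenstein `R`, the `ε`-classes with `𝒪(L) = R` are all invertible (`ICM_R = Pic(R)`).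
[cite: Marseglia2019, §2 Prop. 2.10, chunk p0005] [cite: HertlingLarabi2026, §5 Thm. 5.6 (c), chunk p0012] -/
theorem forall_mul_div_eq_iff_traceDual_mul_div_eq {R : Submodule ℤ (Π i, L i)} (hR : IsFullLattice (Π i, L i) R)
    (h1 : (1 : Π i, L i) ∈ R) (hRR : R * R ≤ R) :
    (∀ I : Submodule ℤ (Π i, L i), IsFullLattice (Π i, L i) I → I / I = R → I * (R / I) = R) ↔
      (Algebra.traceForm ℚ (Π i, L i)).dualSubmodule R * (R / (Algebra.traceForm ℚ (Π i, L i)).dualSubmodule R) =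
        R :=
  ⟨traceDual_mul_div_eq_of_forall_mul_div_eq hR h1 hRR, fun h _ hI hIO =>
    forall_mul_div_eq_of_forall_div_div_eq hR h1 hRR
      (fun _ hJ hRJ => forall_div_div_eq_of_traceDual_mul_div_eq hR h1 hRR h hJ hRJ) hI hIO⟩

/-- **A full lattice whose multiplicator ring `𝒪(I)` is GORENSTEIN (`𝒪(I)^t` invertible) is invertible in `𝒪(I)`:
`I·(𝒪(I):I) = 𝒪(I)`** — Prop. 2.10 (3) ⟹ (2) for the order `𝒪(I)` («If `R` is Bass then every over-order is
Gorenstein and in particular every fractional `R`-ideal `I` is invertible in its own multiplicator ring `S`. This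
means that `{I}` is in `Pic(S)`», i.e. `ICM(R) = ⊔ Pic(S)`). [cite: Marseglia2019, §2 Prop. 2.10 and §3 (3.1), Prop. 3.7 (a) ⟹ (b), chunks p0005–p0006] -/
theorem mul_div_div_eq_of_traceDual_div_self_mul_div_eq {I : Submodule ℤ (Π i, L i)}
    (hI : IsFullLattice (Π i, L i) I)
    (h3 : (Algebra.traceForm ℚ (Π i, L i)).dualSubmodule (I / I) *
      ((I / I) / (Algebra.traceForm ℚ (Π i, L i)).dualSubmodule (I / I)) = I / I) :
    I * ((I / I) / I) = I / I :=
  (forall_mul_div_eq_iff_traceDual_mul_div_eq (isFullLattice_div hI hI) (one_mem_div_self I)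
    (div_self_mul_div_self_eq I).le).2 h3 I hI rfl

/-- **«`𝒪_K` is Gorenstein»: the trace dual of the maximal order `𝒪_Y = ⊕ᵢ 𝒪_{Lᵢ}` is invertible**, condition (3)
(by Cor. 6.2 (b): every lattice with order `𝒪_Y` is invertible, and `𝒪(𝒪_Y^t) = 𝒪_Y`).
[cite: Marseglia2019, §2 Prop. 2.10 («Observe that `𝒪_K` is Gorenstein»), chunk p0005] [cite: HertlingLarabi2026, §6 Cor. 6.2 (b), chunk p0015] -/
theorem traceDual_pi_mul_div_eq :
    (Algebra.traceForm ℚ (Π i, L i)).dualSubmodule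
        (Submodule.pi Set.univ (fun i => Subalgebra.toSubmodule (integralClosure ℤ (L i)))) *
      (Submodule.pi Set.univ (fun i => Subalgebra.toSubmodule (integralClosure ℤ (L i))) /
        (Algebra.traceForm ℚ (Π i, L i)).dualSubmodule
          (Submodule.pi Set.univ (fun i => Subalgebra.toSubmodule (integralClosure ℤ (L i))))) =
      Submodule.pi Set.univ (fun i => Subalgebra.toSubmodule (integralClosure ℤ (L i))) := by
  have hR : IsFullLattice (Π i, L i)
      (Submodule.pi Set.univ (fun i => Subalgebra.toSubmodule (integralClosure ℤ (L i)))) :=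
    isFullLattice_piIntegralSubmodule
  have hRR : Submodule.pi Set.univ (fun i => Subalgebra.toSubmodule (integralClosure ℤ (L i))) *
      Submodule.pi Set.univ (fun i => Subalgebra.toSubmodule (integralClosure ℤ (L i))) ≤
      Submodule.pi Set.univ (fun i => Subalgebra.toSubmodule (integralClosure ℤ (L i))) :=
    Submodule.mul_le.2 fun a ha b hb => mul_mem_piIntegralSubmodule ha hb
  have hO := (div_self_traceDual hR).trans (div_self_eq_of_one_mem one_mem_piIntegralSubmodule hRR)
  exact mul_div_eq_of_div_self_eq_pi (isFullLattice_traceDual hR) hO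

end Gorenstein

end Literature.NumberTheory.ComplexMultiplication
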